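import Literature.NumberTheory.LFunctions.RayClassSmoothedPsi
import Literature.NumberTheory.LFunctions.ClassGroupUnsmoothing
import HarnessLib

/-!
# The Chebyshev functions `θ_τ`, `ψ_τ` of a coset of a congruence class group and their unsmoothing

Topic `Literature/NumberTheory/LFunctions`, namespace `Literature.NumberTheory.LFunctions.AbelianDensity`; the ray-class
counterpart of the tree's `ClassGroupUnsmoothing.lean`.  Everything here is PROVED; `fiberPsi`, `fiberTheta` are
definitions with bodies.

For an abelian Frobenius datum `f : 𝔭 ↦ f 𝔭 ∈ G` (`F = artinSymbol f`), a modulus `𝔪` and `τ ∈ G`: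
* `fiberPsi 𝔪 f τ x = ψ_τ(x) = Σ_{n ≤ x} Λ_τ(n)` and
  `fiberTheta 𝔪 f τ x = θ_τ(x) = Σ_{N𝔭 ≤ x, (𝔭,𝔪)=1, f 𝔭 = τ} log N𝔭` (sum over the nonzero prime ideals of norm
  `≤ x`; Thorner–Zaman's `θ_C(x)` for a coset `C` of `H`);
* `0 ≤ θ_τ ≤ ψ_τ ≤ ψ_K`, `ψ_τ(y) − ψ_τ(x) ≤ ψ_K(y) − ψ_K(x)`, `ψ_τ(x) − θ_τ(x) ≤ ψ_K(x) − θ_K(x)`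
  (`fiberPsi_sub_fiberTheta_le`);
* the smoothing sandwich for the Thorner–Zaman weight `g_x = tzTest (log x) ε`:
  `ψ̃_τ(g_x) ≤ ψ_τ(x e^ε)`, `ψ_τ(x) ≤ ψ̃_τ(g_x) + ψ_τ(√x)` (`smoothedPsiFiber_le_fiberPsi`,
  `fiberPsi_le_smoothedPsiFiber_add`), and the two-sided comparison
  `|θ_τ(x) − ψ̃_τ(g_x)| ≤ ψ_K(√x) + (ψ_K(xe^ε) − ψ_K(x)) + (ψ_K(x) − θ_K(x))` (`abs_fiberTheta_sub_smoothedPsiFiber_le`);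
* `exists_prime_of_fiberTheta_pos` — `θ_τ(x) > 0` gives a prime `𝔭 ∤ 𝔪` with `f 𝔭 = τ`, `N𝔭 ≤ x`.

## References
* [ThornerZaman2017] J. Thorner, A. Zaman, Algebra Number Theory 11 (2017), §3 (3.3), §9.
* [ThornerZaman2019] J. Thorner, A. Zaman, Algebra Number Theory 13 (2019), §2.4, §5 (5.3).
-/

noncomputable section

open Finset Real IsDedekindDomain NumberField
open scoped NumberField nonZeroDivisors

namespace Literature.NumberTheory.LFunctions.AbelianDensity

open Literature.NumberTheory.LFunctions.NumberField Literature.NumberTheory.LFunctions.TZWeight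
open scoped Classical

variable {K : Type} [Field K] [NumberField K]
variable {G : Type*} [CommGroup G] {𝔪 : Ideal (𝓞 K)} {f : HeightOneSpectrum (𝓞 K) → G}

/-! ### `ψ_τ` and `θ_τ` -/

variable (𝔪 f) in
/-- **`ψ_τ(x) = Σ_{n ≤ x} Λ_τ(n)`**, the Chebyshev `ψ`-function of the coset `τ`. [cite: ThornerZaman2019, §2.4] -/
def fiberPsi (τ : G) (x : ℝ) : ℝ :=
  ∑ n ∈ Icc 0 ⌊x⌋₊, vonMangoldtFiber 𝔪 f τ n

variable (𝔪 f) in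
/-- **`θ_τ(x) = Σ_{N𝔭 ≤ x, (𝔭, 𝔪) = 1, F(𝔭) = τ} log N𝔭`** over the nonzero prime ideals of norm `≤ x`
(Thorner–Zaman's `θ_C`). [cite: ThornerZaman2017, §3 (3.3)] -/
def fiberTheta (τ : G) (x : ℝ) : ℝ :=
  ∑ P ∈ (finite_primeIdealsLE K x).toFinset, fiberIndicatorIdeal 𝔪 f τ P * Real.log (Ideal.absNorm P)

/-- `0 ≤ ψ_τ(x)`. [cite: ThornerZaman2019, §2.4] -/
theorem fiberPsi_nonneg (τ : G) (x : ℝ) : 0 ≤ fiberPsi 𝔪 f τ x :=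
  sum_nonneg fun n _ ↦ vonMangoldtFiber_nonneg τ n

/-- `ψ_τ` is monotone. [cite: ThornerZaman2019, §2.4] -/
theorem fiberPsi_mono (τ : G) : Monotone (fiberPsi 𝔪 f τ) := by
  intro x y hxy
  exact sum_le_sum_of_subset_of_nonneg (Icc_subset_Icc le_rfl (Nat.floor_le_floor hxy))
    fun n _ _ ↦ vonMangoldtFiber_nonneg τ n

/-- `ψ_τ(x) ≤ ψ_K(x)`. [cite: ThornerZaman2019, §2.4] -/
theorem fiberPsi_le_chebyshevPsiIdeal (τ : G) (x : ℝ) : fiberPsi 𝔪 f τ x ≤ chebyshevPsiIdeal K x := by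
  rw [chebyshevPsiIdeal_eq_sum_vonMangoldtNorm]
  exact sum_le_sum fun n _ ↦ vonMangoldtFiber_le_vonMangoldtNorm τ n

/-- **Increments of `ψ_τ` are bounded by those of `ψ_K`**: `ψ_τ(y) − ψ_τ(x) ≤ ψ_K(y) − ψ_K(x)` for `x ≤ y`.
[cite: ThornerZaman2019, §2.4] -/
theorem fiberPsi_sub_le (τ : G) {x y : ℝ} (hxy : x ≤ y) :
    fiberPsi 𝔪 f τ y - fiberPsi 𝔪 f τ x ≤ chebyshevPsiIdeal K y - chebyshevPsiIdeal K x := by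
  rw [chebyshevPsiIdeal_eq_sum_vonMangoldtNorm, chebyshevPsiIdeal_eq_sum_vonMangoldtNorm]
  unfold fiberPsi
  have hsub : Icc 0 ⌊x⌋₊ ⊆ Icc 0 ⌊y⌋₊ := Icc_subset_Icc le_rfl (Nat.floor_le_floor hxy)
  rw [← sum_sdiff hsub, ← sum_sdiff hsub, add_sub_cancel_right, add_sub_cancel_right]
  exact sum_le_sum fun n _ ↦ vonMangoldtFiber_le_vonMangoldtNorm τ n

/-- `0 ≤ θ_τ(x)`. [cite: ThornerZaman2017, §3 (3.3)] -/
theorem fiberTheta_nonneg (τ : G) (x : ℝ) : 0 ≤ fiberTheta 𝔪 f τ x :=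
  sum_nonneg fun P _ ↦ mul_nonneg (fiberIndicatorIdeal_mem τ P).1 (Real.log_natCast_nonneg _)

/-- **`θ_τ(x) > 0` produces a prime**: there is a prime `𝔭 ∤ 𝔪` with `f 𝔭 = τ` and `N𝔭 ≤ x`.
[cite: ThornerZaman2017, Theorem 3.1] -/
theorem exists_prime_of_fiberTheta_pos (τ : G) {x : ℝ} (hθ : 0 < fiberTheta 𝔪 f τ x) :
    ∃ v : HeightOneSpectrum (𝓞 K), ¬ 𝔪 ≤ v.asIdeal ∧ f v = τ ∧ (Ideal.absNorm v.asIdeal : ℝ) ≤ x := by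
  obtain ⟨P, hPmem, hne⟩ := Finset.exists_ne_zero_of_sum_ne_zero hθ.ne'
  rw [mem_primeIdealsLE_toFinset] at hPmem
  obtain ⟨hprime, hP0, hle⟩ := hPmem
  have hind : P ≠ ⊥ ∧ IsCoprime P 𝔪 ∧ artinSymbol f P = τ := by
    by_contra h
    apply hne
    unfold fiberIndicatorIdeal; rw [if_neg h, zero_mul]
  set v : HeightOneSpectrum (𝓞 K) := ⟨P, hprime, hP0⟩ with hv
  refine ⟨v, fun hm ↦ ?_, ?_, hle⟩
  · have h := hind.2.1
    rw [Ideal.isCoprime_iff_sup_eq, sup_eq_left.2 hm] at h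
    exact hprime.ne_top h
  · have := artinSymbol_asIdeal f v
    rw [hv] at this; dsimp only at this
    rw [← this]; exact hind.2.2

/-! ### `θ_τ ≤ ψ_τ` and `ψ_τ − θ_τ ≤ ψ_K − θ_K` -/

/-- The ideals of norm at most `x`, as the disjoint union over the norm. [folklore] -/
private theorem pairwiseDisjoint_idealsOfNorm (s : Finset ℕ) :
    (s : Set ℕ).PairwiseDisjoint (idealsOfNorm K) := by
  intro m _ n _ hmn
  rw [Function.onFun, Finset.disjoint_left]
  intro I hIm hIn
  rw [mem_idealsOfNorm] at hIm hIn
  exact hmn (hIm.symm.trans hIn)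

/-- `ψ_τ(x)` as a sum over the ideals of norm `≤ x`. [folklore] -/
private theorem fiberPsi_eq_sum_biUnion (τ : G) (x : ℝ) :
    fiberPsi 𝔪 f τ x = ∑ I ∈ (Icc 0 ⌊x⌋₊).biUnion (idealsOfNorm K), fiberIndicatorIdeal 𝔪 f τ I * idealVonMangoldt I := by
  unfold fiberPsi vonMangoldtFiber
  rw [Finset.sum_biUnion (pairwiseDisjoint_idealsOfNorm _)]

/-- `ψ_K(x)` as a sum over the ideals of norm `≤ x`. [folklore] -/
private theorem chebyshevPsiIdeal_eq_sum_biUnion (x : ℝ) :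
    chebyshevPsiIdeal K x = ∑ I ∈ (Icc 0 ⌊x⌋₊).biUnion (idealsOfNorm K), idealVonMangoldt I := by
  rw [chebyshevPsiIdeal_eq_sum_vonMangoldtNorm, Finset.sum_biUnion (pairwiseDisjoint_idealsOfNorm _)]
  rfl

/-- The nonzero primes of norm `≤ x` inside the ideals of norm `≤ x` (`0 ≤ x`). [folklore] -/
private theorem primeIdealsLE_eq_filter {x : ℝ} (hx : 0 ≤ x) :
    (finite_primeIdealsLE K x).toFinset =
      ((Icc 0 ⌊x⌋₊).biUnion (idealsOfNorm K)).filter (fun I ↦ I.IsPrime ∧ I ≠ ⊥) := by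
  ext P
  rw [mem_primeIdealsLE_toFinset, mem_filter, mem_biUnion]
  constructor
  · rintro ⟨hprime, hP0, hle⟩
    exact ⟨⟨Ideal.absNorm P, mem_Icc.2 ⟨Nat.zero_le _, Nat.le_floor hle⟩, by rw [mem_idealsOfNorm]⟩, hprime, hP0⟩
  · rintro ⟨⟨n, hn, hP⟩, hprime, hP0⟩
    rw [mem_idealsOfNorm] at hP
    refine ⟨hprime, hP0, ?_⟩
    rw [hP]; exact (Nat.le_floor_iff hx).1 (mem_Icc.1 hn).2

/-- `Λ(𝔭) = log N𝔭` for a nonzero prime. [folklore] -/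
private theorem idealVonMangoldt_of_prime {P : Ideal (𝓞 K)} (hprime : P.IsPrime) (hP0 : P ≠ ⊥) :
    idealVonMangoldt P = Real.log (Ideal.absNorm P) := by
  have := idealVonMangoldt_prime_pow (Ideal.prime_of_isPrime hP0 hprime) one_ne_zero
  rwa [pow_one] at this

/-- `θ_τ(x)` as a sum of `𝟙_τ(𝔭) Λ(𝔭)` over the nonzero primes among the ideals of norm `≤ x` (`0 ≤ x`). [folklore] -/
private theorem fiberTheta_eq_sum_filter (τ : G) {x : ℝ} (hx : 0 ≤ x) :
    fiberTheta 𝔪 f τ x = ∑ I ∈ ((Icc 0 ⌊x⌋₊).biUnion (idealsOfNorm K)).filter (fun I ↦ I.IsPrime ∧ I ≠ ⊥),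
      fiberIndicatorIdeal 𝔪 f τ I * idealVonMangoldt I := by
  unfold fiberTheta
  rw [primeIdealsLE_eq_filter hx]
  refine sum_congr rfl fun P hP ↦ ?_
  rw [mem_filter] at hP
  rw [idealVonMangoldt_of_prime hP.2.1 hP.2.2]

/-- `θ_K(x)` likewise (`0 ≤ x`). [folklore] -/
private theorem chebyshevThetaIdeal_eq_sum_filter {x : ℝ} (hx : 0 ≤ x) :
    chebyshevThetaIdeal K x = ∑ I ∈ ((Icc 0 ⌊x⌋₊).biUnion (idealsOfNorm K)).filter (fun I ↦ I.IsPrime ∧ I ≠ ⊥),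
      idealVonMangoldt I := by
  rw [chebyshevThetaIdeal_eq_sum_primeIdealsLE K hx, primeIdealsLE_eq_filter hx]
  refine sum_congr rfl fun P hP ↦ ?_
  rw [mem_filter] at hP
  rw [idealVonMangoldt_of_prime hP.2.1 hP.2.2]

/-- **`θ_τ(x) ≤ ψ_τ(x)`**. [cite: ThornerZaman2019, §2.4] -/
theorem fiberTheta_le_fiberPsi (τ : G) (x : ℝ) : fiberTheta 𝔪 f τ x ≤ fiberPsi 𝔪 f τ x := by
  rcases lt_or_ge x 0 with hx | hx
  · have : fiberTheta 𝔪 f τ x = 0 := by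
      unfold fiberTheta
      refine sum_eq_zero fun P hP ↦ ?_
      rw [mem_primeIdealsLE_toFinset] at hP
      have : (0 : ℝ) ≤ (Ideal.absNorm P : ℝ) := Nat.cast_nonneg _
      linarith [hP.2.2]
    rw [this]; exact fiberPsi_nonneg τ x
  rw [fiberTheta_eq_sum_filter τ hx, fiberPsi_eq_sum_biUnion]
  exact sum_le_sum_of_subset_of_nonneg (filter_subset _ _)
    fun I _ _ ↦ mul_nonneg (fiberIndicatorIdeal_mem τ I).1 (idealVonMangoldt_nonneg I)

/-- **`ψ_τ(x) − θ_τ(x) ≤ ψ_K(x) − θ_K(x)`** (`0 ≤ x`): the difference is the `𝟙_τ`-weighted von Mangoldt sum over the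
ideals of norm `≤ x` that are not nonzero primes, and `𝟙_τ ≤ 1`. [cite: ThornerZaman2019, §2.4] -/
theorem fiberPsi_sub_fiberTheta_le (τ : G) {x : ℝ} (hx : 0 ≤ x) :
    fiberPsi 𝔪 f τ x - fiberTheta 𝔪 f τ x ≤ chebyshevPsiIdeal K x - chebyshevThetaIdeal K x := by
  set U := (Icc 0 ⌊x⌋₊).biUnion (idealsOfNorm K) with hU
  rw [fiberTheta_eq_sum_filter τ hx, fiberPsi_eq_sum_biUnion, chebyshevThetaIdeal_eq_sum_filter hx,
    chebyshevPsiIdeal_eq_sum_biUnion, ← hU]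
  rw [← sum_filter_add_sum_filter_not U (fun I ↦ I.IsPrime ∧ I ≠ ⊥)
      (fun I ↦ fiberIndicatorIdeal 𝔪 f τ I * idealVonMangoldt I),
    ← sum_filter_add_sum_filter_not U (fun I ↦ I.IsPrime ∧ I ≠ ⊥) (fun I ↦ idealVonMangoldt I)]
  rw [add_sub_cancel_left, add_sub_cancel_left]
  refine sum_le_sum fun I _ ↦ ?_
  have h := fiberIndicatorIdeal_mem (𝔪 := 𝔪) (f := f) τ I
  have h0 := idealVonMangoldt_nonneg I
  nlinarith [h.1, h.2]

/-! ### The smoothing sandwich for the Thorner–Zaman weight -/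

/-- **`ψ̃_τ(g_x) ≤ ψ_τ(x e^{ε})`** for `g_x = tzTest (log x) ε`. [cite: ThornerZaman2019, §2.4 Lemma 2.3] -/
theorem smoothedPsiFiber_le_fiberPsi (τ : G) {x ε : ℝ} (hx : 1 < x) (hε : 0 < ε) :
    smoothedPsiFiber 𝔪 f τ (tzTest (Real.log x) ε) ≤ fiberPsi 𝔪 f τ (x * Real.exp ε) := by
  have hL : 0 < Real.log x := Real.log_pos hx
  have hx0 : 0 < x := by linarith
  set N : ℕ := ⌊x * Real.exp ε⌋₊ + 1 with hN
  have hN1 : 1 ≤ N := by omega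
  have hxe : 0 < x * Real.exp ε := by positivity
  have hNlog : Real.log x + ε ≤ Real.log N := by
    have h1 : x * Real.exp ε ≤ N := by rw [hN]; push_cast; exact (Nat.lt_floor_add_one _).le
    have := Real.log_le_log hxe h1
    rwa [Real.log_mul hx0.ne' (Real.exp_pos ε).ne', Real.log_exp] at this
  rw [smoothedPsiFiber_eq_sum τ (fun u hu ↦ tzTest_eq_zero_of_ge hL hε hu) hN1 hNlog]
  unfold fiberPsi
  have hrange : Finset.range N = Icc 0 ⌊x * Real.exp ε⌋₊ := by
    ext n; rw [Finset.mem_range, mem_Icc, hN]; omega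
  rw [hrange]
  refine Finset.sum_le_sum fun n _ ↦ ?_
  have h01 := tzTest_mem_Icc (Real.log x) ε (Real.log n)
  have h0 := vonMangoldtFiber_nonneg (𝔪 := 𝔪) (f := f) τ n
  nlinarith [h01.2]

/-- **`ψ_τ(x) ≤ ψ̃_τ(g_x) + ψ_τ(√x)`** (`g_x(log n) = 1` for `√x ≤ n ≤ x`). [cite: ThornerZaman2019, §2.4 Lemma 2.3] -/
theorem fiberPsi_le_smoothedPsiFiber_add (τ : G) {x ε : ℝ} (hx : 1 < x) (hε : 0 < ε) :
    fiberPsi 𝔪 f τ x ≤ smoothedPsiFiber 𝔪 f τ (tzTest (Real.log x) ε) + fiberPsi 𝔪 f τ (Real.sqrt x) := by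
  have hL : 0 < Real.log x := Real.log_pos hx
  have hx0 : 0 < x := by linarith
  set N : ℕ := ⌊x * Real.exp ε⌋₊ + 1 with hN
  have hN1 : 1 ≤ N := by omega
  have hxe : 0 < x * Real.exp ε := by positivity
  have hNlog : Real.log x + ε ≤ Real.log N := by
    have h1 : x * Real.exp ε ≤ N := by rw [hN]; push_cast; exact (Nat.lt_floor_add_one _).le
    have := Real.log_le_log hxe h1
    rwa [Real.log_mul hx0.ne' (Real.exp_pos ε).ne', Real.log_exp] at this
  rw [smoothedPsiFiber_eq_sum τ (fun u hu ↦ tzTest_eq_zero_of_ge hL hε hu) hN1 hNlog]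
  unfold fiberPsi
  have hsplit : Icc 0 ⌊x⌋₊ = Icc 0 ⌊Real.sqrt x⌋₊ ∪ Finset.Ioc ⌊Real.sqrt x⌋₊ ⌊x⌋₊ := by
    have hsx : ⌊Real.sqrt x⌋₊ ≤ ⌊x⌋₊ := Nat.floor_le_floor (by
      rw [Real.sqrt_le_left hx0.le]; nlinarith)
    ext n; simp only [mem_Icc, Finset.mem_union, Finset.mem_Ioc]; omega
  have hdisj : Disjoint (Icc 0 ⌊Real.sqrt x⌋₊) (Finset.Ioc ⌊Real.sqrt x⌋₊ ⌊x⌋₊) := by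
    rw [Finset.disjoint_left]; intro n h1 h2; rw [mem_Icc] at h1; rw [Finset.mem_Ioc] at h2; omega
  rw [hsplit, Finset.sum_union hdisj, add_comm]
  refine add_le_add ?_ le_rfl
  have hsub : Finset.Ioc ⌊Real.sqrt x⌋₊ ⌊x⌋₊ ⊆ Finset.range N := by
    intro n hn
    rw [Finset.mem_Ioc] at hn; rw [Finset.mem_range, hN]
    have : ⌊x⌋₊ ≤ ⌊x * Real.exp ε⌋₊ := Nat.floor_le_floor (by
      have := Real.one_le_exp hε.le; nlinarith)
    omega
  calc ∑ n ∈ Finset.Ioc ⌊Real.sqrt x⌋₊ ⌊x⌋₊, vonMangoldtFiber 𝔪 f τ n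
      = ∑ n ∈ Finset.Ioc ⌊Real.sqrt x⌋₊ ⌊x⌋₊, vonMangoldtFiber 𝔪 f τ n * tzTest (Real.log x) ε (Real.log n) := by
        refine Finset.sum_congr rfl fun n hn ↦ ?_
        rw [Finset.mem_Ioc] at hn
        have hn0 : (0 : ℝ) < n := by exact_mod_cast (show 0 < n by omega)
        have h1 : Real.sqrt x < n := by
          have := Nat.lt_of_floor_lt hn.1
          exact_mod_cast this
        have h2 : (n : ℝ) ≤ x := by
          have := Nat.floor_le hx0.le
          have : (n : ℝ) ≤ ⌊x⌋₊ := by exact_mod_cast hn.2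
          linarith
        have hlog1 : Real.log x / 2 ≤ Real.log n := by
          have := Real.log_le_log (Real.sqrt_pos.2 hx0) h1.le
          rwa [Real.log_sqrt hx0.le] at this
        have hlog2 : Real.log n ≤ Real.log x := Real.log_le_log hn0 h2
        rw [tzTest_eq_one hL hε hlog1 hlog2, mul_one]
    _ ≤ ∑ n ∈ Finset.range N, vonMangoldtFiber 𝔪 f τ n * tzTest (Real.log x) ε (Real.log n) := by
        refine Finset.sum_le_sum_of_subset_of_nonneg hsub fun n _ _ ↦ ?_
        exact mul_nonneg (vonMangoldtFiber_nonneg τ n) (tzTest_mem_Icc _ _ _).1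

/-- **Unsmoothing, coset by coset**: for `x > 1`, `ε > 0`, `g_x = tzTest (log x) ε`,
`|θ_τ(x) − ψ̃_τ(g_x)| ≤ ψ_K(√x) + (ψ_K(xe^ε) − ψ_K(x)) + (ψ_K(x) − θ_K(x))` (each coset error is at most the
corresponding total). [cite: ThornerZaman2019, §5 (5.3)] -/
theorem abs_fiberTheta_sub_smoothedPsiFiber_le (τ : G) {x ε : ℝ} (hx : 1 < x) (hε : 0 < ε) :
    |fiberTheta 𝔪 f τ x - smoothedPsiFiber 𝔪 f τ (tzTest (Real.log x) ε)| ≤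
      chebyshevPsiIdeal K (Real.sqrt x) + (chebyshevPsiIdeal K (x * Real.exp ε) - chebyshevPsiIdeal K x) +
        (chebyshevPsiIdeal K x - chebyshevThetaIdeal K x) := by
  have hx0 : 0 ≤ x := by linarith
  have h1 := fiberTheta_le_fiberPsi (𝔪 := 𝔪) (f := f) τ x
  have h2 := fiberPsi_le_smoothedPsiFiber_add (𝔪 := 𝔪) (f := f) τ hx hε
  have h3 := smoothedPsiFiber_le_fiberPsi (𝔪 := 𝔪) (f := f) τ hx hε
  have hexp : x ≤ x * Real.exp ε := by have := Real.one_le_exp hε.le; nlinarith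
  have hA := fiberPsi_le_chebyshevPsiIdeal (𝔪 := 𝔪) (f := f) τ (Real.sqrt x)
  have hB := fiberPsi_sub_le (𝔪 := 𝔪) (f := f) τ hexp
  have hC := fiberPsi_sub_fiberTheta_le (𝔪 := 𝔪) (f := f) τ hx0
  have hpos := fiberPsi_nonneg (𝔪 := 𝔪) (f := f) τ (Real.sqrt x)
  have hBpos : 0 ≤ fiberPsi 𝔪 f τ (x * Real.exp ε) - fiberPsi 𝔪 f τ x := sub_nonneg.2 (fiberPsi_mono τ hexp)
  rw [abs_le]; constructor <;> linarith

end Literature.NumberTheory.LFunctions.AbelianDensity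

end
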